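import Literature.AnabelianGeometry.SemiGraphs.ProSigmaCompletionExtend
import Mathlib.GroupTheory.NoncommCoprod
import Mathlib.Topology.Instances.ZMod
import Mathlib.Algebra.Group.TypeTags.Finite
import Mathlib.Data.ZMod.Basic
import HarnessLib

/-!
# Central elements of pro-`Σ` completions: separation and the basis character at a finite level

[AbsAnab] (Mochizuki, *The absolute anabelian geometry of hyperbolic curves*, 2004) Lemma 1.3.1 p. 15:
the pro-`Σ` fundamental groups of hyperbolic curves are slim [cite: MochizukiAbsAnab2004, Lemma 1.3.1 p.15];
[SemiAnbd] Example 2.10 p. 31 ("verticially slim") [cite: MochizukiSemiAnbd2006, Ex. 2.10 p.31].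

abc-iut-L5-t9's `ProSigmaCompletionSlim.lean` proves the affine (free) case in two steps that use the
freeness of `Γ` only through the *coordinate characters* of two free generators, followed by a lifting
step that genuinely needs freeness.  This file isolates the first two steps for an ARBITRARY group `Γ`
equipped with two elements `a₁, a₂` and integer characters `d₁, d₂ : Γ → ℤ` with `dᵢ(aⱼ) = δᵢⱼ` (for a
surface group: two of the standard generators and the corresponding coordinates of the abelianisation),
so that the closed-surface case can replace the lifting step (`ProSigmaClosedSurfaceSlim.lean`):

* `exists_openNormal_not_mem_zpowers_of_characters` — **separation**: for `ι : Γ → P` a pro-`Σ`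
  completion (`P` profinite) and `z ∈ P`, `z ≠ 1`, for `a = a₁` or `a = a₂` there is an open normal
  `N ⊴ P` with the class of `z` in `P/N` NOT a power of the class of `ι(a)`;
* `exists_basisCharacter_of_not_mem_zpowers` — **the basis character**: if moreover `z` commutes with
  `τ = ι(a)`, then at some finite level there are a prime `p ∈ Σ`, an open subgroup `U ∋ τ`, an element
  `κ ∈ U` commuting with `τ` (a power of a twist of `z` by a power of `τ`), and a continuous
  `ψ : U → 𝔽_p × 𝔽_p` with `ψ(τ) = (1, 0)`, `ψ(κ) = (0, 1)`.

Both proofs are abc-iut-L5-t9's, verbatim up to the replacement of `IsFreeGroup.lift` by the given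
characters.  Theorems only; classical profinite group theory; nothing here bears on [IUTchIII] Cor. 3.12.
-/

namespace Literature.AnabelianGeometry.SemiGraphs.SemiGraphOfAnabelioids.IsProSigmaCompletion

open Literature.AnabelianGeometry.Anabelioids Topology
open Multiplicative

variable {Sigma : Set ℕ} {Γ : Type*} [Group Γ] {P : Type*} [Group P] [TopologicalSpace P]
  {ι : Γ →* P}

section Profinite

variable [IsTopologicalGroup P] [CompactSpace P] [TotallyDisconnectedSpace P]

/-! ### Step 1: separating `z ≠ 1` from the powers of `ι(a₁)` or of `ι(a₂)` at a finite level -/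

/-- **Separation.**  Let `ι : Γ → P` be a pro-`Σ` completion (`P` profinite), `a₁, a₂ ∈ Γ` with integer
characters `d₁, d₂ : Γ → ℤ` with `d₁(a₁) = 1`, `d₂(a₁) = 0`, `d₂(a₂) = 1` (e.g. `dᵢ(aⱼ) = δᵢⱼ`), and `z ∈ P`, `z ≠ 1`.  Then for `a = a₁` or `a = a₂` — returned
together with its character `d`, `d(a) = 1` — there is an open normal subgroup `N ⊴ P` such that the class
of `z` in `P/N` is NOT a power of the class of `ι(a)`.  (Otherwise, with `N₀ ∌ z` open normal and the
mod-`[P:N₀]` reductions `χ₁, χ₂ : P → ℤ/[P:N₀]` of `d₁, d₂` extended continuously, at the level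
`N = N₀ ∩ Ker χ₁ ∩ Ker χ₂` the relation `z ≡ ι(a₂)^{s}` forces `[P:N₀] ∣ s`, whence `z ∈ N₀`.)
abc-iut-L5-t9's `exists_openNormal_not_mem_zpowers` with characters for generators.
[cite: MochizukiAbsAnab2004, Lemma 1.3.1 p.15] -/
theorem exists_openNormal_not_mem_zpowers_of_characters [T2Space P]
    (hι : IsProSigmaCompletion Sigma ι) {a₁ a₂ : Γ} (d₁ d₂ : Γ →* Multiplicative ℤ)
    (h11 : d₁ a₁ = ofAdd 1) (h21 : d₂ a₁ = 1) (h22 : d₂ a₂ = ofAdd 1)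
    {z : P} (hz1 : z ≠ 1) :
    ∃ (a : Γ) (d : Γ →* Multiplicative ℤ), d a = ofAdd 1 ∧ ∃ N : OpenNormalSubgroup P,
      (QuotientGroup.mk z : P ⧸ (N : Subgroup P)) ∉
        Subgroup.zpowers (QuotientGroup.mk (ι a)) := by
  classical
  -- an open normal `N₀` missing `z`
  obtain ⟨N₀, hN₀⟩ := ProfiniteGrp.exist_openNormalSubgroup_sub_open_nhds_of_one
    (isOpen_compl_singleton (x := z)) (show (1 : P) ∈ ({z}ᶜ : Set P) from fun h => hz1 h.symm)
  have hzN₀ : z ∉ (N₀ : Subgroup P) := fun h => hN₀ h rfl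
  haveI : (N₀ : Subgroup P).Normal := N₀.isNormal'
  obtain ⟨n, hndef⟩ : ∃ n, n = (N₀ : Subgroup P).index := ⟨_, rfl⟩
  have hn : IsSigmaInteger Sigma n := hndef ▸ hι.index_open _ N₀.isNormal' N₀.isOpen'
  haveI : NeZero n := ⟨hn.1.ne'⟩
  have hcard : IsSigmaInteger Sigma (Nat.card (Multiplicative (ZMod n))) := by
    rw [show Nat.card (Multiplicative (ZMod n)) = n from Nat.card_zmod n]; exact hn
  -- the characters `dᵢ` reduced mod `n`, extended continuously to `P`
  let red : Multiplicative ℤ →* Multiplicative (ZMod n) := (Int.castAddHom (ZMod n)).toMultiplicative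
  have hred1 : red (ofAdd 1) = ofAdd 1 := by
    change ofAdd (((1 : ℤ) : ZMod n)) = ofAdd 1
    rw [Int.cast_one]
  obtain ⟨χ₁, hχ₁c, hχ₁⟩ := exists_continuous_extend_top hι hcard (red.comp d₁)
  obtain ⟨χ₂, hχ₂c, hχ₂⟩ := exists_continuous_extend_top hι hcard (red.comp d₂)
  have hχ₂a₁ : χ₂ (ι a₁) = 1 := by rw [hχ₂, MonoidHom.comp_apply, h21, map_one]
  have hχ₂a₂ : χ₂ (ι a₂) = ofAdd 1 := by rw [hχ₂, MonoidHom.comp_apply, h22, hred1]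
  -- the level `N = N₀ ∩ Ker χ₁ ∩ Ker χ₂`
  have hk₁ : IsOpen (χ₁.ker : Set P) := (isOpen_discrete ({1} : Set _)).preimage hχ₁c
  have hk₂ : IsOpen (χ₂.ker : Set P) := (isOpen_discrete ({1} : Set _)).preimage hχ₂c
  let K₁ : OpenNormalSubgroup P := { toSubgroup := χ₁.ker, isOpen' := hk₁ }
  let K₂ : OpenNormalSubgroup P := { toSubgroup := χ₂.ker, isOpen' := hk₂ }
  let N : OpenNormalSubgroup P := (N₀ ⊓ K₁) ⊓ K₂
  have hNle₀ : (N : Subgroup P) ≤ (N₀ : Subgroup P) := fun x hx => hx.1.1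
  have hNle₂ : (N : Subgroup P) ≤ χ₂.ker := fun x hx => hx.2
  by_contra hcon
  push Not at hcon
  have h1 := hcon a₁ d₁ h11 N
  have h2 := hcon a₂ d₂ h22 N
  obtain ⟨s₁, hs₁⟩ := Subgroup.mem_zpowers_iff.mp h1
  obtain ⟨s₂, hs₂⟩ := Subgroup.mem_zpowers_iff.mp h2
  have hs₁' : (ι a₁ ^ s₁)⁻¹ * z ∈ (N : Subgroup P) := by
    rw [← QuotientGroup.eq, QuotientGroup.mk_zpow]
    exact hs₁
  have hs₂' : (ι a₂ ^ s₂)⁻¹ * z ∈ (N : Subgroup P) := by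
    rw [← QuotientGroup.eq, QuotientGroup.mk_zpow]
    exact hs₂
  -- apply `χ₂` to `z ≡ ι(a₁)^{s₁}`: `χ₂ z = 1`
  have e1 : χ₂ z = 1 := by
    have h := hNle₂ hs₁'
    rw [MonoidHom.mem_ker, map_mul, map_inv, map_zpow, hχ₂a₁, one_zpow, inv_one, one_mul] at h
    exact h
  -- apply `χ₂` to `z ≡ ι(a₂)^{s₂}`: `χ₂ z = s₂ mod n`
  have e2 : χ₂ z = ofAdd ((s₂ : ℤ) : ZMod n) := by
    have h := hNle₂ hs₂'
    rw [MonoidHom.mem_ker, map_mul, map_inv, map_zpow, hχ₂a₂, inv_mul_eq_one] at h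
    rw [← h, ← ofAdd_zsmul, zsmul_one]
  have hdvd : (n : ℤ) ∣ s₂ := by
    rw [e1, eq_comm, ofAdd_eq_one, ZMod.intCast_zmod_eq_zero_iff_dvd] at e2
    exact e2
  -- hence `ι(a₂)^{s₂} ∈ N₀` and `z ∈ N₀`
  obtain ⟨c, hc⟩ := hdvd
  have hτn : ι a₂ ^ (n : ℤ) ∈ (N₀ : Subgroup P) := by
    rw [zpow_natCast, hndef]
    exact Subgroup.pow_index_mem _ _
  have hτs : ι a₂ ^ s₂ ∈ (N₀ : Subgroup P) := by
    rw [hc, zpow_mul]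
    exact Subgroup.zpow_mem _ hτn c
  have hN₀' : (ι a₂ ^ s₂)⁻¹ * z ∈ (N₀ : Subgroup P) := hNle₀ hs₂'
  apply hzN₀
  have := (N₀ : Subgroup P).mul_mem hτs hN₀'
  rwa [mul_inv_cancel_left] at this

/-! ### Step 2: the basis character at one finite level -/

/-- **The basis character.**  Let `ι : Γ → P` be a pro-`Σ` completion (`P` profinite), `a ∈ Γ` with an
integer character `d : Γ → ℤ`, `d(a) = 1`, `τ = ι(a)`, `N ⊴ P` open normal, and `z ∈ P` an element
COMMUTING with `τ` whose class in `P/N` is not a power of the class of `τ`.  Then there are a prime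
`p ∈ Σ`, an open subgroup `U ∋ τ`, an element `κ ∈ U` commuting with `τ`, and a continuous homomorphism
`ψ : U → 𝔽_p × 𝔽_p` (multiplicative notation) with `ψ(τ) = (1, 0)`, `ψ(κ) = (0, 1)`.  (Twist `z` by
`τ^{-c}` into the kernel of the continuous extension `χ : P → ℤ/m` of `d` mod `m = |P/N|`; a power `κ` of
the twist has prime order `p` in `P/N`, `p ∣ m`, `p ∈ Σ`; with `Ψ = (P → P/N, χ)`, the open subgroup
`U = Ψ⁻¹⟨Ψτ, Ψκ⟩` carries `ψ` = reduction mod `p` of the exponents.)  abc-iut-L5-t9's construction in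
`false_of_not_mem_zpowers`, stopped before the lifting step. [cite: MochizukiAbsAnab2004, Lemma 1.3.1 p.15] -/
theorem exists_basisCharacter_of_not_mem_zpowers (hι : IsProSigmaCompletion Sigma ι)
    (N : Subgroup P) [N.Normal] (hN : IsOpen (N : Set P)) {a : Γ} (d : Γ →* Multiplicative ℤ)
    (hda : d a = ofAdd 1) {z : P} (hz : ι a * z = z * ι a)
    (hsep : (QuotientGroup.mk z : P ⧸ N) ∉ Subgroup.zpowers (QuotientGroup.mk (ι a))) :
    ∃ (p : ℕ) (_ : Fact p.Prime), p ∈ Sigma ∧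
      ∃ (U : Subgroup P) (_ : IsOpen (U : Set P)) (κ : P) (hτU : ι a ∈ U) (hκU : κ ∈ U),
        ι a * κ = κ * ι a ∧
        ∃ ψ : U →* Multiplicative (ZMod p) × Multiplicative (ZMod p), Continuous ψ ∧
          ψ ⟨ι a, hτU⟩ = (ofAdd 1, 1) ∧ ψ ⟨κ, hκU⟩ = (1, ofAdd 1) := by
  classical
  set τ : P := ι a with hτdef
  haveI : Finite (P ⧸ N) := Subgroup.quotient_finite_of_isOpen N hN
  haveI : DiscreteTopology (P ⧸ N) := QuotientGroup.discreteTopology hN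
  let π : P →* P ⧸ N := QuotientGroup.mk' N
  have hπc : Continuous π := QuotientGroup.continuous_mk
  -- `m = |P/N|`
  obtain ⟨m, hmdef⟩ : ∃ m, m = Nat.card (P ⧸ N) := ⟨_, rfl⟩
  have hm : IsSigmaInteger Sigma m := by
    rw [hmdef, ← Subgroup.index_eq_card]
    exact isSigmaInteger_index hι N hN
  haveI : NeZero m := ⟨hm.1.ne'⟩
  have hπm : ∀ x, (π x) ^ m = 1 := fun x => by rw [hmdef]; exact pow_card_eq_one'
  -- the character `χ : P → ℤ/m` extending `d` mod `m`, `χ τ = 1`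
  let redm : Multiplicative ℤ →* Multiplicative (ZMod m) := (Int.castAddHom (ZMod m)).toMultiplicative
  have hredm1 : redm (ofAdd 1) = ofAdd 1 := by
    change ofAdd (((1 : ℤ) : ZMod m)) = ofAdd 1
    rw [Int.cast_one]
  have hcard : IsSigmaInteger Sigma (Nat.card (Multiplicative (ZMod m))) := by
    rw [show Nat.card (Multiplicative (ZMod m)) = m from Nat.card_zmod m]; exact hm
  obtain ⟨χ, hχc, hχ⟩ := exists_continuous_extend_top hι hcard (redm.comp d)
  have hχτ : χ τ = ofAdd 1 := by rw [hτdef, hχ, MonoidHom.comp_apply, hda, hredm1]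
  -- twist `z` into `Ker χ`
  set k : P := z * (τ ^ (toAdd (χ z)).val)⁻¹ with hkdef
  have hχk : χ k = 1 := by
    rw [hkdef, map_mul, map_inv, map_pow, hχτ, ← ofAdd_nsmul, nsmul_eq_mul, mul_one,
      ZMod.natCast_zmod_val, ofAdd_toAdd, mul_inv_cancel]
  have hτk : Commute τ k := by
    rw [hkdef]
    exact (show Commute τ z from hz).mul_right ((Commute.refl τ).pow_right _).inv_right
  have hπk : π k ≠ 1 := by
    intro h
    apply hsep
    have h' : π z = π τ ^ (toAdd (χ z)).val := by
      have h'' : π z * (π τ ^ (toAdd (χ z)).val)⁻¹ = 1 := by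
        rw [← map_pow, ← map_inv, ← map_mul]; exact h
      exact mul_inv_eq_one.mp h''
    change π z ∈ Subgroup.zpowers (π τ)
    rw [h']
    exact Subgroup.pow_mem _ (Subgroup.mem_zpowers _) _
  -- a prime `p` and a power `κ` of `k` whose image has order `p`
  have ho0 : orderOf (π k) ≠ 0 := (orderOf_pos (π k)).ne'
  have ho1 : orderOf (π k) ≠ 1 := fun h => hπk (orderOf_eq_one_iff.mp h)
  obtain ⟨p, hpdef⟩ : ∃ p, p = (orderOf (π k)).minFac := ⟨_, rfl⟩
  haveI hp : Fact p.Prime := ⟨hpdef ▸ Nat.minFac_prime ho1⟩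
  have hpo : p ∣ orderOf (π k) := hpdef ▸ Nat.minFac_dvd _
  obtain ⟨κ, hκdef⟩ : ∃ κ, κ = k ^ (orderOf (π k) / p) := ⟨_, rfl⟩
  have hκord : orderOf (π κ) = p := by
    rw [hκdef, map_pow]
    exact orderOf_pow_orderOf_div ho0 hpo
  have hc₁ : τ * κ = κ * τ := by
    rw [hκdef]
    exact (hτk.pow_right _).eq
  have hκχ : χ κ = 1 := by rw [hκdef, map_pow, hχk, one_pow]
  have hpm : p ∣ m := by rw [← hκord, hmdef]; exact orderOf_dvd_natCard (π κ)
  have hpS : p ∈ Sigma := hm.2 p hp.out hpm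
  -- `Ψ = (π, χ)`
  let Ψ : P →* (P ⧸ N) × Multiplicative (ZMod m) := π.prod χ
  have hΨc : Continuous Ψ := hπc.prodMk hχc
  have hΨτ : Ψ τ = (π τ, ofAdd 1) := by
    change (π τ, χ τ) = _
    rw [hχτ]
  have hΨκ : Ψ κ = (π κ, 1) := by
    change (π κ, χ κ) = _
    rw [hκχ]
  -- the abelian image `C = ⟨Ψ τ, Ψ κ⟩` as the range of `gC : ℤ × ℤ → P/N × ℤ/m`
  have hcomm : Commute (Ψ τ) (Ψ κ) := by
    change Ψ τ * Ψ κ = Ψ κ * Ψ τ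
    rw [← map_mul, hc₁, map_mul]
  let gC : Multiplicative ℤ × Multiplicative ℤ →* (P ⧸ N) × Multiplicative (ZMod m) :=
    MonoidHom.noncommCoprod (zpowersHom _ (Ψ τ)) (zpowersHom _ (Ψ κ))
      fun u v => (hcomm.zpow_left u.toAdd).zpow_right v.toAdd
  have hgC : ∀ u v : Multiplicative ℤ, gC (u, v) = Ψ τ ^ u.toAdd * Ψ κ ^ v.toAdd := fun u v => rfl
  let C := gC.range
  let U : Subgroup P := C.comap Ψ
  have hτU : τ ∈ U := ⟨(ofAdd 1, 1), by rw [hgC]; simp⟩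
  have hκU : κ ∈ U := ⟨(1, ofAdd 1), by rw [hgC]; simp⟩
  have hUo : IsOpen (U : Set P) := by
    change IsOpen (Ψ ⁻¹' (C : Set ((P ⧸ N) × Multiplicative (ZMod m))))
    exact (isOpen_discrete _).preimage hΨc
  -- the kernel of `gC` dies under reduction mod `p`
  let red : Multiplicative ℤ →* Multiplicative (ZMod p) := (Int.castAddHom (ZMod p)).toMultiplicative
  have hred : ∀ u : Multiplicative ℤ, (p : ℤ) ∣ u.toAdd → red u = 1 := by
    intro u hu
    change ofAdd ((u.toAdd : ZMod p)) = 1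
    rw [(ZMod.intCast_zmod_eq_zero_iff_dvd u.toAdd p).mpr hu, ofAdd_zero]
  let βt : Multiplicative ℤ × Multiplicative ℤ →* Multiplicative (ZMod p) × Multiplicative (ZMod p) :=
    red.prodMap red
  have hτ2 : (Ψ τ).2 = ofAdd 1 := by rw [hΨτ]
  have hκ2 : (Ψ κ).2 = 1 := by rw [hΨκ]
  have hker : gC.rangeRestrict.ker ≤ βt.ker := by
    rw [MonoidHom.ker_rangeRestrict]
    rintro ⟨u, v⟩ huv
    rw [MonoidHom.mem_ker, hgC] at huv
    -- second coordinate: `m ∣ u`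
    have h2 := congrArg (MonoidHom.snd (P ⧸ N) (Multiplicative (ZMod m))) huv
    rw [map_mul, map_zpow, map_zpow, map_one, MonoidHom.coe_snd, hτ2, hκ2, one_zpow, mul_one,
      ← ofAdd_zsmul, zsmul_one, ofAdd_eq_one, ZMod.intCast_zmod_eq_zero_iff_dvd] at h2
    -- first coordinate: `p ∣ v`
    have h1 := congrArg (MonoidHom.fst (P ⧸ N) (Multiplicative (ZMod m))) huv
    rw [map_mul, map_zpow, map_zpow, map_one, MonoidHom.coe_fst] at h1
    change π τ ^ u.toAdd * π κ ^ v.toAdd = 1 at h1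
    obtain ⟨c, hc⟩ := h2
    rw [hc, zpow_mul, zpow_natCast, hπm, one_zpow, one_mul, ← orderOf_dvd_iff_zpow_eq_one,
      hκord] at h1
    have hu : (p : ℤ) ∣ u.toAdd := (Int.natCast_dvd_natCast.mpr hpm).trans ⟨c, hc⟩
    rw [MonoidHom.mem_ker]
    exact Prod.ext (hred u hu) (hred v h1)
  let β : C →* Multiplicative (ZMod p) × Multiplicative (ZMod p) :=
    gC.rangeRestrict.liftOfSurjective gC.rangeRestrict_surjective ⟨βt, hker⟩
  have hβ : ∀ w, β (gC.rangeRestrict w) = βt w := fun w =>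
    MonoidHom.liftOfRightInverse_comp_apply _ _ _ _ w
  -- `ψ : U → (ℤ/p)²`, `τ ↦ (1, 0)`, `κ ↦ (0, 1)` (written multiplicatively)
  let ΨU : U →* C := (Ψ.comp U.subtype).codRestrict C fun x => x.2
  let ψ : U →* Multiplicative (ZMod p) × Multiplicative (ZMod p) := β.comp ΨU
  have hΨU : ∀ (x : P) (hx : x ∈ U) (w : Multiplicative ℤ × Multiplicative ℤ),
      gC w = Ψ x → ΨU ⟨x, hx⟩ = gC.rangeRestrict w := fun x hx w hw => Subtype.ext hw.symm
  have hred1 : red (ofAdd 1) = ofAdd 1 := by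
    change ofAdd (((1 : ℤ) : ZMod p)) = ofAdd 1
    rw [Int.cast_one]
  have hψτ : ψ ⟨τ, hτU⟩ = (ofAdd 1, 1) := by
    change β (ΨU ⟨τ, hτU⟩) = _
    rw [hΨU τ hτU (ofAdd 1, 1) (by rw [hgC]; simp), hβ]
    change (red (ofAdd 1), red 1) = _
    rw [map_one red, hred1]
  have hψκ : ψ ⟨κ, hκU⟩ = (1, ofAdd 1) := by
    change β (ΨU ⟨κ, hκU⟩) = _
    rw [hΨU κ hκU (1, ofAdd 1) (by rw [hgC]; simp), hβ]
    change (red 1, red (ofAdd 1)) = _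
    rw [map_one red, hred1]
  have hψc : Continuous ψ := by
    have h1 : Continuous ΨU := (hΨc.comp continuous_subtype_val).subtype_mk _
    have h2 : Continuous β := continuous_of_discreteTopology
    exact h2.comp h1
  exact ⟨p, hp, hpS, U, hUo, κ, hτU, hκU, hc₁, ψ, hψc, hψτ, hψκ⟩

end Profinite

end Literature.AnabelianGeometry.SemiGraphs.SemiGraphOfAnabelioids.IsProSigmaCompletion
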